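import Mathlib.NumberTheory.NumberField.ClassNumber
import Mathlib.Topology.Algebra.InfiniteSum.Constructions
import HarnessLib

/-!
# Regrouping an Euler product over the primes of `𝓞 K` by the rational prime below

Topic `NumberTheory/NumberFields` (namespace `Literature.NumberTheory.NumberFields`). Everything
here is PROVED (theorems and two auxiliary definitions, no named facts).

For a number field `K`, every nonzero prime `𝔭` of `𝓞 K` lies over a unique rational prime
`p` (`𝔭 ∩ ℤ = pℤ`); we record this as the function `natPrimeUnder : Ideal (𝓞 K) → ℕ`
(`= absNorm (𝔭 ∩ ℤ)`), the fibration `HeightOneSpectrum (𝓞 K) → Nat.Primes` with finite fibres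
`{𝔭 : 𝔭 ∣ p} = primesOver pℤ`, and the resulting **regrouping of unconditionally convergent
products** (the step "collect the Euler factors of the primes `𝔭 ∣ p`" in every comparison of
`ζ_K(s) = ∏_𝔭 (1 − 𝔑(𝔭)^{−s})⁻¹`, Neukirch, *Algebraic Number Theory*, Ch. VII (5.2), with Euler
products over rational primes, e.g. Marcus, *Number Fields*, Ch. 7, for `ζ_K` of an abelian
field as a product of Dirichlet `L`-functions):

* `HasProd.primesOver_regroup` — if `∏_𝔭 G(𝔭)` converges unconditionally to `a` (product over
  `HeightOneSpectrum (𝓞 K)`), then so does `∏_p ∏_{𝔭 ∣ p} G(𝔭)` (product over `Nat.Primes`, the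
  inner product being the finite product `∏ᶠ 𝔭 ∈ primesOver pℤ, G 𝔭`).

This is the step by which the Euler product `ζ_K(s) = ∏_𝔭 (1 − N𝔭^{−s})⁻¹`
(`Literature.NumberTheory.LFunctions.hasProd_dedekindEulerFactor`, proved in
`LFunctions/DedekindZetaProofs.lean`) is compared with Euler products over rational primes
(`riemannZeta_eulerProduct_hasProd`, `DirichletCharacter.LSeries_eulerProduct_hasProd`), e.g.
`ζ_K = ζ · L(χ_{d_K})` for quadratic `K` (`QuadraticFields/QuadraticDedekindZeta.lean`).
Mathlib has `primesOver`, its finiteness (`IsDedekindDomain.primesOver_finite`), `HasProd.sigma`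
and `Equiv.sigmaFiberEquiv`, but not this regrouping (searched `primesOver` with `HasProd`,
`tprod`).

## References

* [NeukirchANT1999] J. Neukirch, *Algebraic Number Theory* (1999), Ch. I §8 (primes lying over
  `p`) and Ch. VII §5, (5.2) (Euler product of `ζ_K`).
* [Marcus2018] D. A. Marcus, *Number Fields*, 2nd ed. (2018), Ch. 3 (splitting of primes) and
  Ch. 7 (the Dedekind zeta function and `L`-series).
-/

noncomputable section

open Ideal IsDedekindDomain NumberField

namespace Literature.NumberTheory.NumberFields

variable {K : Type*} [Field K] [NumberField K]

/-! ### The rational prime below a prime of `𝓞 K` -/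

/-- The natural number generating `P ∩ ℤ`: for a nonzero prime `P` of `𝓞 K` this is the rational
prime `p` below `P`. [folklore] -/
def natPrimeUnder (P : Ideal (𝓞 K)) : ℕ :=
  absNorm (P.under ℤ)

omit [NumberField K] in
/-- `P ∩ ℤ = (natPrimeUnder P)`. [folklore] -/
theorem span_natPrimeUnder (P : Ideal (𝓞 K)) :
    span {(natPrimeUnder P : ℤ)} = P.under ℤ :=
  Int.ideal_span_absNorm_eq_self _

omit [NumberField K] in
/-- `P` lies over `(natPrimeUnder P)`. [folklore] -/
theorem liesOver_natPrimeUnder (P : Ideal (𝓞 K)) :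
    P.LiesOver (span {(natPrimeUnder P : ℤ)}) :=
  ⟨span_natPrimeUnder P⟩

omit [NumberField K] in
/-- For a nonzero prime `P`, `natPrimeUnder P` is a prime number. [folklore] -/
theorem natPrimeUnder_prime {P : Ideal (𝓞 K)} (hP : P.IsPrime) (hP0 : P ≠ ⊥) :
    (natPrimeUnder P).Prime := by
  have hu : (P.under ℤ).IsPrime := hP.under ℤ
  have hu0 : P.under ℤ ≠ ⊥ := fun h => hP0 (eq_bot_of_comap_eq_bot (R := ℤ) h)
  rw [← span_natPrimeUnder P] at hu hu0
  have h0 : (natPrimeUnder P : ℤ) ≠ 0 := fun h => hu0 (by rw [h, span_singleton_eq_bot.mpr rfl])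
  exact Nat.prime_iff_prime_int.mpr ((span_singleton_prime h0).mp hu)

omit [NumberField K] in
/-- If `P` lies over `pℤ` then `natPrimeUnder P = p`. [folklore] -/
theorem natPrimeUnder_eq_of_liesOver {P : Ideal (𝓞 K)} {p : ℕ}
    [h : P.LiesOver (span {(p : ℤ)})] : natPrimeUnder P = p := by
  have h1 : span {(natPrimeUnder P : ℤ)} = span {(p : ℤ)} := by
    rw [span_natPrimeUnder, ← h.over]
  have h2 := Int.associated_iff_natAbs.mp (span_singleton_eq_span_singleton.mp h1)
  simpa using h2

omit [NumberField K] in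
/-- Membership in `primesOver pℤ` in terms of `natPrimeUnder`. [folklore] -/
theorem mem_primesOver_iff_natPrimeUnder {P : Ideal (𝓞 K)} (hP : P.IsPrime) (p : ℕ) :
    P ∈ primesOver (span {(p : ℤ)}) (𝓞 K) ↔ natPrimeUnder P = p := by
  constructor
  · rintro ⟨-, hl⟩
    exact natPrimeUnder_eq_of_liesOver
  · rintro rfl
    exact ⟨hP, liesOver_natPrimeUnder P⟩

/-- A prime over `pℤ` (`p` prime) is a nonzero prime. [folklore] -/
theorem ne_bot_of_mem_primesOver {P : Ideal (𝓞 K)} {p : ℕ} (hp : p.Prime)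
    (h : P ∈ primesOver (span {(p : ℤ)}) (𝓞 K)) : P ≠ ⊥ := by
  haveI := h.2
  have hp0 : span {(p : ℤ)} ≠ ⊥ := by
    rw [Ne, span_singleton_eq_bot]
    exact_mod_cast hp.ne_zero
  exact ne_bot_of_liesOver_of_ne_bot hp0 P

/-! ### The fibration of the primes of `𝓞 K` over the rational primes -/

/-- The rational prime below a nonzero prime of `𝓞 K`, as an element of `Nat.Primes`. [folklore] -/
def toNatPrimes (v : HeightOneSpectrum (𝓞 K)) : Nat.Primes :=
  ⟨natPrimeUnder v.asIdeal, natPrimeUnder_prime v.isPrime v.ne_bot⟩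

/-- The fibre of `toNatPrimes` over `p` is in bijection with `primesOver pℤ`, by `v ↦ v.asIdeal`.
[folklore] -/
def fiberEquivPrimesOver (p : Nat.Primes) :
    {v : HeightOneSpectrum (𝓞 K) // toNatPrimes v = p} ≃ primesOver (span {((p : ℕ) : ℤ)}) (𝓞 K) where
  toFun v := ⟨v.1.asIdeal,
    (mem_primesOver_iff_natPrimeUnder v.1.isPrime p).mpr (congrArg Subtype.val v.2)⟩
  invFun P := ⟨⟨P.1, P.2.1, ne_bot_of_mem_primesOver p.2 P.2⟩,
    Subtype.ext ((mem_primesOver_iff_natPrimeUnder P.2.1 p).mp P.2)⟩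
  left_inv v := by
    rcases v with ⟨⟨P, hP, hP0⟩, hv⟩
    rfl
  right_inv P := by
    rcases P with ⟨P, hP⟩
    rfl

/-- The fibres of `toNatPrimes` are finite. [folklore] -/
instance finite_fiber (p : Nat.Primes) :
    Finite {v : HeightOneSpectrum (𝓞 K) // toNatPrimes v = p} := by
  haveI : (span {((p : ℕ) : ℤ)}).IsMaximal :=
    ((span_singleton_prime (by exact_mod_cast p.2.ne_zero)).mpr
      (Nat.prime_iff_prime_int.mp p.2)).isMaximal (by
        rw [Ne, span_singleton_eq_bot]; exact_mod_cast p.2.ne_zero)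
  haveI : Finite (primesOver (span {((p : ℕ) : ℤ)}) (𝓞 K)) :=
    (IsDedekindDomain.primesOver_finite (span {((p : ℕ) : ℤ)}) (𝓞 K)).to_subtype
  exact Finite.of_equiv _ (fiberEquivPrimesOver p).symm

/-- The finite product over a fibre is the `finprod` over `primesOver pℤ`. [folklore] -/
theorem prod_fiber_eq_finprod (G : Ideal (𝓞 K) → ℂ) (p : Nat.Primes)
    [Fintype {v : HeightOneSpectrum (𝓞 K) // toNatPrimes v = p}] :
    ∏ v : {v : HeightOneSpectrum (𝓞 K) // toNatPrimes v = p}, G v.1.asIdeal =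
      ∏ᶠ P ∈ primesOver (span {((p : ℕ) : ℤ)}) (𝓞 K), G P := by
  classical
  haveI : Fintype (primesOver (span {((p : ℕ) : ℤ)}) (𝓞 K)) :=
    Fintype.ofEquiv _ (fiberEquivPrimesOver p)
  rw [← finprod_set_coe_eq_finprod_mem, finprod_eq_prod_of_fintype]
  exact Fintype.prod_equiv (fiberEquivPrimesOver p) _ _ fun v => rfl

/-- **Regrouping an unconditionally convergent product over the primes of `𝓞 K` by the rational
prime below.** If `∏_𝔭 G(𝔭) = a` unconditionally (over `HeightOneSpectrum (𝓞 K)`), then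
`∏_p (∏_{𝔭 ∣ p} G(𝔭)) = a` unconditionally over the rational primes `p`, the inner products being
finite (`primesOver pℤ` is finite): `HasProd.sigma` along the fibration `toNatPrimes`
(`Equiv.sigmaFiberEquiv`). [folklore] -/
theorem HasProd.primesOver_regroup {G : Ideal (𝓞 K) → ℂ} {a : ℂ}
    (h : HasProd (fun v : HeightOneSpectrum (𝓞 K) => G v.asIdeal) a) :
    HasProd (fun p : Nat.Primes => ∏ᶠ P ∈ primesOver (span {((p : ℕ) : ℤ)}) (𝓞 K), G P) a := by
  classical
  set e := Equiv.sigmaFiberEquiv (toNatPrimes (K := K)) with he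
  have h1 : HasProd ((fun v : HeightOneSpectrum (𝓞 K) => G v.asIdeal) ∘ e) a :=
    (e.hasProd_iff).mpr h
  refine h1.sigma fun p => ?_
  haveI : Fintype {v : HeightOneSpectrum (𝓞 K) // toNatPrimes v = p} := Fintype.ofFinite _
  have h2 := hasProd_fintype (fun c : {v : HeightOneSpectrum (𝓞 K) // toNatPrimes v = p} =>
    ((fun v : HeightOneSpectrum (𝓞 K) => G v.asIdeal) ∘ e) ⟨p, c⟩)
  rwa [show (∏ c : {v : HeightOneSpectrum (𝓞 K) // toNatPrimes v = p},
      ((fun v : HeightOneSpectrum (𝓞 K) => G v.asIdeal) ∘ e) ⟨p, c⟩) =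
      ∏ᶠ P ∈ primesOver (span {((p : ℕ) : ℤ)}) (𝓞 K), G P from ?_] at h2
  rw [← prod_fiber_eq_finprod G p]
  rfl

end Literature.NumberTheory.NumberFields
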